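import Mathlib
import Summits.ValiantsHypothesis.ValiantsHypothesis.Theorems.FifoMatchingNNLinearDegreeCofactorHardAvoidingCountsOfPricing
import Summits.ValiantsHypothesis.ValiantsHypothesis.Theorems.FifoMatchingNNLinearDegreeCofactorHardStubTopInternalComponent
import Summits.ValiantsHypothesis.ValiantsHypothesis.Theorems.FifoMatchingNNLinearDegreeCofactorHardStubLongRunInternalHard
import Summits.ValiantsHypothesis.ValiantsHypothesis.Theorems.FifoMatchingNNLinearDegreeCofactorHardRateGrowthRoot
import Summits.ValiantsHypothesis.ValiantsHypothesis.Theorems.FifoMatchingNNLinearDegreeCofactorHardGoodCarving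
import Summits.ValiantsHypothesis.ValiantsHypothesis.Theorems.FifoMatchingNNLinearDegreeCofactorHardShedWordMeasureTight
import HarnessLib

/-!
# Route `FifoMatching`, crux `NNLinearDegreeCofactorHard` (stmt-ValiantsHypothesis-23918), line `internal_cofactor`:
# μ* = shedWord AT THE INTERFACE DENSITY — the avoiding counts and the crux with `a = 28`

The crux was closed by `ShedWord.NNLinearDegreeCofactorHard_proof` (p1) with the density constant `a = 1024`
(`ShedWordMeasure.pricing_large` needs `1012 · #R′ ≤ N + 4`).  This file runs the SAME assembly at the minimum density the
pricing interface admits, `a = 28` (trace density `1/16`), using the tight measure `ShedWordMeasureTight.pricing_large_tight`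
(p3's `heart_popped_tight` + `ParamsTight.rate_of_heart_tight`), and thereby discharges — unconditionally — the hypotheses of
LEAD p2's original by-name chain `avoidingCounts28_of_pricing` (p602549) → `nnLinearDegreeCofactorHard_of_avoidingCounts28`
(p599455):

* `rate_tight_growth` — the rate `M ↦ root16 (2M) / 32` (`0` below `root16 (2M) < 4096`) grows like a 16-th root (`hr_of_root`);
* `shedWord_pricing_tight` — the measure hypothesis `hμ` of `avoidingCounts28_of_pricing` (every `n`; band measure above the
  threshold, one-point drain measure `ShedWordMeasure.pricing_small` below);
* `avoidingCounts28` — THE AVOIDING COUNTS AT DENSITY `28` (hypothesis of `denseInternalHard_of_counts 28` /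
  `nnLinearDegreeCofactorHard_of_avoidingCounts28`), no hypotheses left;
* `denseInternalHard_twentyEight` — S2b at density `28` by name (`denseInternalHard_of_counts 28`);
* `nnLinearDegreeCofactorHard_twentyEight` — the crux's conclusion with the EXPLICIT constant `a = 28`: for every `c` and all
  large `n`, every nonzero `g` over `ℝ≥0` with `28 · deg g ≤ n` has `L₊(NF_{2n} · g) + L₊(g) > 2^((log₂ n + c)^c)`
  (so `⟨28, nnLinearDegreeCofactorHard_twentyEight⟩` is a second closing term of the route statement, through p2's chain
  `nnLinearDegreeCofactorHard_of_avoidingCounts28 avoidingCounts28`; not restated here since the item is closed).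

HONEST FRAMING: monotone (ℝ≥0) complexity only; this strengthens the constant of an already-proved crux and does NOT prove
`NNDivisionHard`, `NNNotVP`, Valiant's hypothesis or VP ≠ VNP (NOT proved).  No definitions, no named facts. [folklore]
-/

noncomputable section

-- Sub = Summit single-conjunct layout: the duplicated namespace component is mandated by the tree.
set_option linter.dupNamespace false

namespace Summit.ValiantsHypothesis.ValiantsHypothesis.Theorems.FifoMatching.NNLinearDegreeCofactorHard.InternalCofactor

open MvPolynomial Finset Literature.Computability.AlgebraicComplexity
open Summit.ValiantsHypothesis.ValiantsHypothesis.Theorems.FifoMatching.NNLowDegreeCofactorHard.FreedVertices.Carve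
open Summit.ValiantsHypothesis.ValiantsHypothesis.Theorems.FifoMatching.NNLinearDegreeCofactorHard
open Summit.ValiantsHypothesis.ValiantsHypothesis.Theorems.FifoMatching.NNLinearDegreeCofactorHard.ShedWord
open scoped NNReal

/-- **Rate growth for `hr_of_root`**: the rate `M ↦ root16 (2M) / 32` (read at the window length `2M`, and `0` below the
threshold `root16 (2M) < 4096`) satisfies `M < (64 (r M + 1))¹⁶` for `M ≥ 4096¹⁶`. [folklore] -/
theorem rate_tight_growth : ∀ M : ℕ, 4096 ^ 16 ≤ M →
    M < (64 * ((fun M => if 4096 ≤ root16 (2 * M) then root16 (2 * M) / 32 else 0) M + 1)) ^ 16 := by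
  intro M hM
  have hg : 4096 ≤ root16 (2 * M) := le_root16 (by omega)
  simp only [if_pos hg]
  exact rate_growth (by omega)

/-- **`hμ` at density `a = 28`**: for EVERY `n`, every defect set `R` with `28 · #R ≤ 2n`, every carving with `3 ≤ C.m`,
`2n ≤ 2 C.m + 12 #R + 4` and end densities `≤ 1/4` of the trace, the shed-word band measure (above the threshold
`root16 (2 C.m) ≥ 4096`; the one-point drain measure below it) has the four properties of the pricing interface with rate
`root16 (2 C.m) / 32` (resp. `0`). [folklore] -/
theorem shedWord_pricing_tight : ∀ n : ℕ, ∀ R : Finset (Fin (2 * n)), 28 * R.card ≤ 2 * n →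
      ∀ C : Carving n, 3 ≤ C.m → 2 * n ≤ 2 * C.m + 12 * R.card + 4 →
        (∀ t ≤ 2 * C.m,
          4 * ((univ.filter fun j : Fin (2 * C.m) => C.up j ∈ R).filter fun j => j.val < t).card ≤ t ∧
          4 * ((univ.filter fun j : Fin (2 * C.m) => C.up j ∈ R).filter
            fun j => 2 * C.m ≤ j.val + t).card ≤ t) →
        ∃ B : ℕ, ∃ BB : Finset (Fin B → Bool), ∃ f : (Fin B → Bool) → (Fin (2 * C.m) → Fin (2 * C.m)),
          BB.Nonempty ∧
          (∀ y ∈ BB, f y ∈ (nestFreeMatchings (2 * C.m)).filter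
            (fun N => ∀ j ∈ (univ.filter fun j : Fin (2 * C.m) => C.up j ∈ R),
              N j ∉ (univ.filter fun j : Fin (2 * C.m) => C.up j ∈ R))) ∧
          (2 : ℝ) ^ B ≤ 2 * BB.card ∧
          ∀ S : Finset (Fin (2 * C.m)), 2 * C.m < 3 * S.card → 3 * S.card ≤ 4 * C.m →
            ((BB.filter fun y => ∀ i, i ∈ S ↔ f y i ∈ S).card : ℝ) *
              (4 / 3 : ℝ) ^ ((fun M => if 4096 ≤ root16 (2 * M) then root16 (2 * M) / 32 else 0) C.m) ≤ 2 ^ B := by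
  intro n R hR C hm hnC hends
  classical
  set R' : Finset (Fin (2 * C.m)) := univ.filter fun j : Fin (2 * C.m) => C.up j ∈ R with hR'
  have hR'le : R'.card ≤ R.card := card_trace_le R C.up C.up_injective
  have h16 : 16 * R'.card ≤ 2 * C.m + 4 := sixteen_mul_le (N := 2 * C.m) (le_refl 28) hR hnC hR'le
  have hN : Even (2 * C.m) := even_two_mul _
  have hpre : ∀ t ≤ 2 * C.m, 4 * (R'.filter fun j => j.val < t).card ≤ t := fun t ht => (hends t ht).1
  have hsuf : ∀ t ≤ 2 * C.m, 4 * (R'.filter fun j => 2 * C.m ≤ j.val + t).card ≤ t := fun t ht => (hends t ht).2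
  by_cases hg : 4096 ≤ root16 (2 * C.m)
  · obtain ⟨BB, f, h1, h2, h3, h4⟩ := pricing_large_tight R' hN hg h16 hpre hsuf
    refine ⟨2 * C.m, BB, f, h1, h2, h3, fun S hS₁ hS₂ => ?_⟩
    simp only [if_pos hg]
    exact h4 S hS₁ (by omega)
  · obtain ⟨BB, f, h1, h2, h3, h4⟩ := pricing_small R' hN hsuf
    refine ⟨2 * C.m, BB, f, h1, h2, h3, fun S hS₁ hS₂ => ?_⟩
    simp only [if_neg hg]
    exact h4 S hS₁ (by omega)

/-- **THE AVOIDING COUNTS AT DENSITY `a = 28`** (the hypothesis of `nnLinearDegreeCofactorHard_of_avoidingCounts28` and of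
`denseInternalHard_of_counts 28`, discharged): μ* priced by `shedWord_pricing_tight`, the rate made super-logarithmic by
`hr_of_root` (`C₀ = 64`, `d = 16`, `M₀ = 4096¹⁶`), assembled by the interface `avoidingCounts28_of_pricing`. [folklore] -/
theorem avoidingCounts28 :
    ∀ c : ℕ, ∃ n₀ : ℕ, ∀ n ≥ n₀, ∀ R : Finset (Fin (2 * n)), 28 * R.card ≤ 2 * n →
      (¬ ∃ s : ℕ, s + (2 * ((Nat.log 2 n + c) ^ c + Nat.log 2 n + 1) ^ 6 + 12) ≤ 2 * n ∧
        ∀ j : Fin (2 * n), s ≤ j.val →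
          j.val < s + (2 * ((Nat.log 2 n + c) ^ c + Nat.log 2 n + 1) ^ 6 + 12) → j ∉ R) →
      ∀ C : Carving n, 3 ≤ C.m → 2 * n ≤ 2 * C.m + 12 * R.card + 4 →
        (∀ t ≤ 2 * C.m,
          4 * ((univ.filter fun j : Fin (2 * C.m) => C.up j ∈ R).filter fun j => j.val < t).card ≤ t ∧
          4 * ((univ.filter fun j : Fin (2 * C.m) => C.up j ∈ R).filter
            fun j => 2 * C.m ≤ j.val + t).card ≤ t) →
        ∃ B : ℕ, ∃ BB : Finset (Fin B → Bool), ∃ f : (Fin B → Bool) → (Fin (2 * C.m) → Fin (2 * C.m)),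
          BB.Nonempty ∧
          (∀ y ∈ BB, f y ∈ (nestFreeMatchings (2 * C.m)).filter
            (fun N => ∀ j ∈ (univ.filter fun j : Fin (2 * C.m) => C.up j ∈ R),
              N j ∉ (univ.filter fun j : Fin (2 * C.m) => C.up j ∈ R))) ∧
          ∀ S : Finset (Fin (2 * C.m)), 2 * C.m < 3 * S.card → 3 * S.card ≤ 4 * C.m →
            (4 * (2 ^ ((Nat.log 2 n + c) ^ c) + 1) * (C.m + 1) ^ 2) *
              (BB.filter fun y => ∀ i, i ∈ S ↔ f y i ∈ S).card < BB.card :=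
  avoidingCounts28_of_pricing _ shedWord_pricing_tight
    (hr_of_root _ 64 16 (4096 ^ 16) (by norm_num) rate_tight_growth)

/-- **S2b at density `28`, by name**: the dense-internal-cofactor hardness `denseInternalHard_of_counts 28` with its counts
hypothesis discharged by `avoidingCounts28`. [folklore] -/
theorem denseInternalHard_twentyEight :
    ∀ c : ℕ, ∃ n₀ : ℕ, ∀ n ≥ n₀, ∀ R : Finset (Fin (2 * n)), 28 * R.card ≤ 2 * n →
      (¬ ∃ s : ℕ, s + (2 * ((Nat.log 2 n + c) ^ c + Nat.log 2 n + 1) ^ 6 + 12) ≤ 2 * n ∧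
        ∀ j : Fin (2 * n), s ≤ j.val →
          j.val < s + (2 * ((Nat.log 2 n + c) ^ c + Nat.log 2 n + 1) ^ 6 + 12) → j ∉ R) →
      ∀ p : MvPolynomial (Fin (2 * n) × Fin (2 * n)) ℝ≥0, p ≠ 0 → 28 * p.totalDegree ≤ n →
        (∀ d ∈ p.support, ∀ e ∈ d.support, e.1 ∈ R ∧ e.2 ∈ R) →
          2 ^ ((Nat.log 2 n + c) ^ c) < complexity (nestFreeMatchingPoly n ℝ≥0 * p) :=
  denseInternalHard_of_counts 28 le_rfl avoidingCounts28

/-- **THE CRUX WITH THE EXPLICIT CONSTANT `a = 28`.**  For every `c` and all large `n`: every nonzero `g` over `ℝ≥0` with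
`28 · deg g ≤ n` has `L₊(NF_{2n} · g) + L₊(g) > 2^((log₂ n + c)^c)` (S1 `stub_topInternalComponent` + S2a
`stub_longRunInternalHard` + S2b `denseInternalHard_twentyEight`; the proof of `nnLinearDegreeCofactorHard_of_avoidingCounts28`
with the witness kept visible).  Monotone world only; VP ≠ VNP is NOT proved. [folklore] -/
theorem nnLinearDegreeCofactorHard_twentyEight : ∀ c : ℕ, ∃ n₀ : ℕ, ∀ n ≥ n₀,
    ∀ g : MvPolynomial (Fin (2 * n) × Fin (2 * n)) ℝ≥0, g ≠ 0 → 28 * g.totalDegree ≤ n →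
      2 ^ ((Nat.log 2 n + c) ^ c) < complexity (nestFreeMatchingPoly n ℝ≥0 * g) + complexity g := by
  intro c
  obtain ⟨n₁, hn₁⟩ := stub_longRunInternalHard c
  obtain ⟨n₂, hn₂⟩ := denseInternalHard_twentyEight c
  refine ⟨max n₁ n₂, fun n hn g hg hdeg => ?_⟩
  obtain ⟨R, hR, p, hp, hpdeg, hint, hpc⟩ := stub_topInternalComponent n g hg
  have hRa : 28 * R.card ≤ 2 * n :=
    calc 28 * R.card ≤ 28 * (2 * g.totalDegree) := Nat.mul_le_mul_left 28 hR
      _ = 2 * (28 * g.totalDegree) := by ring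
      _ ≤ 2 * n := Nat.mul_le_mul_left 2 hdeg
  have hpa : 28 * p.totalDegree ≤ n := (Nat.mul_le_mul_left 28 hpdeg).trans hdeg
  have key : 2 ^ ((Nat.log 2 n + c) ^ c) < complexity (nestFreeMatchingPoly n ℝ≥0 * p) := by
    by_cases hrun : ∃ s : ℕ, s + (2 * ((Nat.log 2 n + c) ^ c + Nat.log 2 n + 1) ^ 6 + 12) ≤ 2 * n ∧
        ∀ j : Fin (2 * n), s ≤ j.val →
          j.val < s + (2 * ((Nat.log 2 n + c) ^ c + Nat.log 2 n + 1) ^ 6 + 12) → j ∉ R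
    · exact hn₁ n (le_of_max_le_left hn) R hrun p hp hint
    · exact hn₂ n (le_of_max_le_right hn) R hRa hrun p hp hpa hint
  calc 2 ^ ((Nat.log 2 n + c) ^ c) < complexity (nestFreeMatchingPoly n ℝ≥0 * p) := key
    _ ≤ complexity (nestFreeMatchingPoly n ℝ≥0 * g) := hpc
    _ ≤ complexity (nestFreeMatchingPoly n ℝ≥0 * g) + complexity g := Nat.le_add_right _ _

end Summit.ValiantsHypothesis.ValiantsHypothesis.Theorems.FifoMatching.NNLinearDegreeCofactorHard.InternalCofactor

end
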